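import Summits.Ventures.PercRepro.RankLevelSetRuleQCell

/-!
# PercRepro — RULE Q AT THE TIGHT LAYER: THE CELL INEQUALITIES `RhatCell q k` BY KERNEL EVALUATION (RankLevelSetRuleQCellEvalW28Q2; night-1, gen 14)

Each theorem `rhatCell_q_k : RhatCell q k` (`∀ m ≤ q, Φ(q+k, q) ≤ R̂(q, k, m)`, RankLevelSetRuleQCell) is discharged by
`interval_cases m` and `norm_num` on the unfolded binomial sums (`Nat.choose` by its recursion; the
`Finset.Ioo`-sums as `Finset.range`-sums via `sum_Ioo_nat`). No `native_decide`, no `decide` on the rationals. With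
`hallUp_of_ncard_eq_of_rhatCell` each cell gives the UP form of C-044 at the tight layer `#E = (q+k) + q` of the cell
`(q+k, q)` for every finite matroid; the DOWN form is `hallDown_of_ncard_eq`. Cells: (2,21), (2,22), (2,23), (2,24).
Axioms: standard.
-/

namespace PercRepro

open Finset

/-- `Φ(23, 2) ≤ R̂(2, 21, 0)` (the cell `(23, 2)` at `#P = 0`), by kernel evaluation. -/
theorem rhatCell_2_21_0 : phiK (2 + 21) 2 ≤ rhat 2 21 0 := by
  simp only [rhat, phiK, mhat, sum_Ioo_nat]
  norm_num [Finset.sum_range_succ, Nat.choose, Nat.min_def]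

/-- `Φ(23, 2) ≤ R̂(2, 21, 1)` (the cell `(23, 2)` at `#P = 1`), by kernel evaluation. -/
theorem rhatCell_2_21_1 : phiK (2 + 21) 2 ≤ rhat 2 21 1 := by
  simp only [rhat, phiK, mhat, sum_Ioo_nat]
  norm_num [Finset.sum_range_succ, Nat.choose, Nat.min_def]

/-- `Φ(23, 2) ≤ R̂(2, 21, 2)` (the cell `(23, 2)` at `#P = 2`), by kernel evaluation. -/
theorem rhatCell_2_21_2 : phiK (2 + 21) 2 ≤ rhat 2 21 2 := by
  simp only [rhat, phiK, mhat, sum_Ioo_nat]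
  norm_num [Finset.sum_range_succ, Nat.choose, Nat.min_def]

/-- The cell `(23, 2)` (`q = 2`, `k = 21`): `Φ(23, 2) ≤ R̂(2, 21, m)` for every `m ≤ 2`. -/
theorem rhatCell_2_21 : RhatCell 2 21 := by
  intro m hm
  interval_cases m
  · exact rhatCell_2_21_0
  · exact rhatCell_2_21_1
  · exact rhatCell_2_21_2

/-- `Φ(24, 2) ≤ R̂(2, 22, 0)` (the cell `(24, 2)` at `#P = 0`), by kernel evaluation. -/
theorem rhatCell_2_22_0 : phiK (2 + 22) 2 ≤ rhat 2 22 0 := by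
  simp only [rhat, phiK, mhat, sum_Ioo_nat]
  norm_num [Finset.sum_range_succ, Nat.choose, Nat.min_def]

/-- `Φ(24, 2) ≤ R̂(2, 22, 1)` (the cell `(24, 2)` at `#P = 1`), by kernel evaluation. -/
theorem rhatCell_2_22_1 : phiK (2 + 22) 2 ≤ rhat 2 22 1 := by
  simp only [rhat, phiK, mhat, sum_Ioo_nat]
  norm_num [Finset.sum_range_succ, Nat.choose, Nat.min_def]

/-- `Φ(24, 2) ≤ R̂(2, 22, 2)` (the cell `(24, 2)` at `#P = 2`), by kernel evaluation. -/
theorem rhatCell_2_22_2 : phiK (2 + 22) 2 ≤ rhat 2 22 2 := by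
  simp only [rhat, phiK, mhat, sum_Ioo_nat]
  norm_num [Finset.sum_range_succ, Nat.choose, Nat.min_def]

/-- The cell `(24, 2)` (`q = 2`, `k = 22`): `Φ(24, 2) ≤ R̂(2, 22, m)` for every `m ≤ 2`. -/
theorem rhatCell_2_22 : RhatCell 2 22 := by
  intro m hm
  interval_cases m
  · exact rhatCell_2_22_0
  · exact rhatCell_2_22_1
  · exact rhatCell_2_22_2

/-- `Φ(25, 2) ≤ R̂(2, 23, 0)` (the cell `(25, 2)` at `#P = 0`), by kernel evaluation. -/
theorem rhatCell_2_23_0 : phiK (2 + 23) 2 ≤ rhat 2 23 0 := by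
  simp only [rhat, phiK, mhat, sum_Ioo_nat]
  norm_num [Finset.sum_range_succ, Nat.choose, Nat.min_def]

/-- `Φ(25, 2) ≤ R̂(2, 23, 1)` (the cell `(25, 2)` at `#P = 1`), by kernel evaluation. -/
theorem rhatCell_2_23_1 : phiK (2 + 23) 2 ≤ rhat 2 23 1 := by
  simp only [rhat, phiK, mhat, sum_Ioo_nat]
  norm_num [Finset.sum_range_succ, Nat.choose, Nat.min_def]

/-- `Φ(25, 2) ≤ R̂(2, 23, 2)` (the cell `(25, 2)` at `#P = 2`), by kernel evaluation. -/
theorem rhatCell_2_23_2 : phiK (2 + 23) 2 ≤ rhat 2 23 2 := by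
  simp only [rhat, phiK, mhat, sum_Ioo_nat]
  norm_num [Finset.sum_range_succ, Nat.choose, Nat.min_def]

/-- The cell `(25, 2)` (`q = 2`, `k = 23`): `Φ(25, 2) ≤ R̂(2, 23, m)` for every `m ≤ 2`. -/
theorem rhatCell_2_23 : RhatCell 2 23 := by
  intro m hm
  interval_cases m
  · exact rhatCell_2_23_0
  · exact rhatCell_2_23_1
  · exact rhatCell_2_23_2

/-- `Φ(26, 2) ≤ R̂(2, 24, 0)` (the cell `(26, 2)` at `#P = 0`), by kernel evaluation. -/
theorem rhatCell_2_24_0 : phiK (2 + 24) 2 ≤ rhat 2 24 0 := by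
  simp only [rhat, phiK, mhat, sum_Ioo_nat]
  norm_num [Finset.sum_range_succ, Nat.choose, Nat.min_def]

/-- `Φ(26, 2) ≤ R̂(2, 24, 1)` (the cell `(26, 2)` at `#P = 1`), by kernel evaluation. -/
theorem rhatCell_2_24_1 : phiK (2 + 24) 2 ≤ rhat 2 24 1 := by
  simp only [rhat, phiK, mhat, sum_Ioo_nat]
  norm_num [Finset.sum_range_succ, Nat.choose, Nat.min_def]

/-- `Φ(26, 2) ≤ R̂(2, 24, 2)` (the cell `(26, 2)` at `#P = 2`), by kernel evaluation. -/
theorem rhatCell_2_24_2 : phiK (2 + 24) 2 ≤ rhat 2 24 2 := by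
  simp only [rhat, phiK, mhat, sum_Ioo_nat]
  norm_num [Finset.sum_range_succ, Nat.choose, Nat.min_def]

/-- The cell `(26, 2)` (`q = 2`, `k = 24`): `Φ(26, 2) ≤ R̂(2, 24, m)` for every `m ≤ 2`. -/
theorem rhatCell_2_24 : RhatCell 2 24 := by
  intro m hm
  interval_cases m
  · exact rhatCell_2_24_0
  · exact rhatCell_2_24_1
  · exact rhatCell_2_24_2

end PercRepro
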